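import Summits.QuantumFields.YangMills.Theorems.BalabanUVNodesN15BackgroundCovariantEntriesAllNode
import Summits.QuantumFields.YangMills.Theorems.BalabanUVNodesN15FullPropagatorV1XCovTwoSidedNode
import Summits.QuantumFields.YangMills.Theorems.BalabanUVNodesN15BackgroundDressedInverseWindow
import HarnessLib

/-!
# `T4EtaRate.NE2PlusOperator` BY NAME FOR THE EXACTLY DRESSED PROPAGATOR WITH ALL FOUR (3.42) ENTRIES COVARIANT — `X`, `∇_{U′}X`, `X∇*_{U′}`, `Δ_{U′}X` — ON THE TORUS FAMILY, and the
# per-lattice identification of the three covariant entries with Bałaban's operators (dag-n15-c g10, FILE 38; Track-A node N15 = NE2, s1 «background-layer OPERATOR ingredient»)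

`--kind definition --supports stmt-QuantumFields-20544 --as helper` (K3⁷; count-neutral).  Imports BY NAME this seat's FILE 37b `…BackgroundCovariantEntriesAllNode` (★★★
`ne2PlusOperator_twoSidedCovAll_of_letters`, FILE 37a `bgFamilyM₂RCC`, `bgOpsM₂RCC`, FILE 36 `covEntry2` ∕ `dressed_comp_covDT_eq_covEntry2` ∕ `covDT`; through it FILE 33 `covEntry1` ∕ `covEntry3` ∕ `covD_comp_dressed_eq_covEntry1` ∕ `covLapM_comp_dressed_eq_covEntry3`, FILE 28
`gaugeTransport` ∕ `tCoefA_gaugeTransport` ∕ `tCoefC_gaugeTransport` ∕ `covLapM`) and FILE 32 `…BackgroundDressedInverseWindow` (★★ `isUnit_neumann_torus_window`; through it FILE 30 `v1cfgFX` ∕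
`v1cfgCX` ∕ ★★ `twoSidedLettersX_torus`, FILE 27 `fgInstanceV1G` ∕ ★★ `uniform_layer_fullGM₂R`, FILE 31 `tensorId_symbOp_sLap` ∕ `tensorId_comp_tensorId`, FILE 21 `dPiecesM₂`); nothing in the
tree is modified.

WHAT.  §1 `fgFamilyV1XA` (def: FILE 37a's `bgFamilyM₂RCC` — all four entries covariant — with the exact readings on FILE 27's instance).  §2 ★★★ `ne2PlusOperatorM1_fullGM₂_v1XA_of_entry2`, ★★★
**`ne2PlusOperatorM1_fullGM₂_v1XA : NE2PlusOperatorM1 c₃₅ (fgInstanceV1G d 𝔄 ι hL) (fgFamilyV1XA d 𝔄 ι e hL b)`** (`γ = 1∕(8(d+1))`, `d ≥ 1`, `L` odd `≥ 3`, hypothesis-free;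
`NE2PlusOperator` corollary `ne2PlusOperator_fullGM₂_v1XA`), `_dim4` — FILE 30 §2's proofs with FILE 37b's node theorem.  §3 ONE per-lattice identification, CONDITIONAL on the two
displayed unit hypotheses (`hunit` = the Neumann unit of FILE 18, `hunit2` = the by-parts unit `E2Unit` of FILE 2; NOT discharged in this file): ★★★ `dressed_covDT_eq_covEntry2_torus`
(entry 2's operator = `X(B)∘(D^η_{exp(η ad B_ν),τ_ν})ᵀ` — the TRANSPOSE-ADJOINT covariant derivative on the test 1-form, FILE 36).  The per-lattice identifications of entries 1 and 3
are FILE 35 §3 (`covD_dressed_eq_covEntry1_torus`, `covLapM_dressed_eq_covEntry3_torus`, same `hunit`).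

HONEST FRAMING.  The operator layer of [B9] Thm 3.1 (3.42) for the Green's function of `Δ_{U′} + (aQ*Q − ∂P∂*)(1) ⊗ 1_𝔤` (FILE 32) with ALL FOUR entries covariant (entry 2 through the
transpose-adjoint = Bałaban's `∇*_{U′}` for coordinates orthonormal w.r.t. the invariant form); MODEL-LEVEL: `DRD*` ∕ `aQ*Q` at `U ≡ 1`, C² reading of (3.35)–(3.36) in one global gauge, `𝔤 ↦ 𝔄` with coordinates, block-mean transport.  NE2⁺ as printed NOT
PRINTED, not claimed; count-neutral; N15 NOT discharged; one finite torus at fixed ε — NOT ℝ⁴, NOT infinite volume, NOT OS, NOT a mass gap, NOT Clay.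
-/

noncomputable section

open scoped BigOperators
open Finset

namespace Summit.QuantumFields.YangMills.BalabanUVNodes.N15.BackgroundLayer

open Literature.MathematicalPhysics.QuantumFieldTheory.Balaban1983to89
open Literature.MathematicalPhysics.QuantumFieldTheory.Balaban1983to89.B11SectG (BlockNorm HasMaj RowSum)
open Literature.MathematicalPhysics.QuantumFieldTheory.Balaban1983to89.T4EtaRate (PairedInstance NE2PlusOperator rateFactor)
open Literature.MathematicalPhysics.QuantumFieldTheory.Balaban1983to89.T4EtaRateDefect (idef idef_apply rateWeight)
open Literature.MathematicalPhysics.QuantumFieldTheory.Balaban1983to89.T4EtaRateCoeffDefect (pull pull_apply diagK diagK_nonneg)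
open Literature.MathematicalPhysics.QuantumFieldTheory.Balaban1983to89.B5Prop11Plancherel (Tor fine unitVec)
open Literature.MathematicalPhysics.QuantumFieldTheory.Balaban1983to89.B5SiteBridgeP12 (MP)
open Literature.MathematicalPhysics.QuantumFieldTheory.Balaban1983to89.B6UnitTorusCarrier (unitTorusGeo triangle254_unitTorusGeo rowSum_unitTorusGeo unitTorusGeo_dist_nonneg
  unitTorusGeo_len)
open Literature.MathematicalPhysics.QuantumFieldTheory.King1986.Torus (blockOf tdistT tdistT_nonneg tdistT_self)
open Summit.QuantumFields.YangMills.BalabanUVNodes.N15.MatrixSpecies (mmulOp liftMap liftBlk liftEquiv liftEquiv_apply liftEquiv_symm_apply basisConst basisConst_nonneg covD)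
open Summit.QuantumFields.YangMills.BalabanUVNodes.N15.TwoGrid (gOp symbOp sT sTinv sD sLap paramsOf hasMaj_rate_mono hasMaj_twoGridDefect_div TGIndex TGIndex.Mn)
open Summit.QuantumFields.YangMills.BalabanUVNodes.N15.VectorPiece (blkFine kingPrV blkFine_comp_kingPrV bshiftEquiv bshiftEquiv_apply bshiftEquiv_symm_apply bshiftV bshiftV_apply
  tensorId tensorId_apply hasMaj_tensorId idef_tensorId kingPrV_bshiftEquiv_pow fibre_conn_kingPrV bshiftEquiv_comm inv_pow_le_rpow)

variable {d : ℕ} {L : ℕ} [NeZero L]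

/-! ## §1 The exactly dressed family with the covariant entries -/

section Family

variable (d) (𝔄 : Type) [NormedRing 𝔄] [NormedAlgebra ℝ 𝔄] [CompleteSpace 𝔄] (ι : Type) [Fintype ι] [DecidableEq ι] (e : 𝔄 ≃L[ℝ] (ι → ℝ))

/-- THE REALISED GAUGE-DRESSED TWO-SIDED BY-PARTS KERNEL FAMILY at `(i, ν)`: FILE 24's `bgFamilyM₂R` with the readings `v1cfgFX` (fine) ∕ `v1cfgCX` (coarse, at the block mean), pieces
`G = gOp ⊗ 1_ι`, `dPiecesM₂` (forward AND backward), `D₃ = (ΔG) ⊗ 1_ι` at both spacings — all four (3.42) entries CONSTRUCTED, entry 2 BY PARTS, Bałaban's OWN `V′₁(A)`.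
[cite: Balaban1985BackgroundPropagators, (3.42) p.397 + (3.52) p.400 (shapes)] -/
def fgFamilyV1XA (hL : Odd L ∧ 1 < L) (b : ℝ) (i : TGIndex × Fin (d + 1)) : B9.KernelFamily (fgInstanceV1G d 𝔄 ι hL i).gc (fgInstanceV1G d 𝔄 ι hL i).Bf :=
  bgFamilyM₂RCC (Fin (d + 1)) ι (g := unitTorusGeo L i.1.k (TGIndex.Mn d hL i.1)) (blkFine L i.1.k (TGIndex.Mn d hL i.1)) (kingPrV L i.1.k i.1.m (TGIndex.Mn d hL i.1)) i.1.m
    (v1GaugeBg 𝔄 (Fin (d + 1)) (fun μ => bshiftEquiv (TGIndex.Mn d hL i.1) (L ^ i.1.k) μ) (unitTorusGeo L i.1.k (TGIndex.Mn d hL i.1)).eta (unitTorusGeo L i.1.k (TGIndex.Mn d hL i.1)).M)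
    (v1GaugeBg 𝔄 (Fin (d + 1)) (fun μ => bshiftEquiv (TGIndex.Mn d hL i.1) (L ^ i.1.m * L ^ i.1.k) μ)
      ((unitTorusGeo L i.1.k (TGIndex.Mn d hL i.1)).eta * ((unitTorusGeo L i.1.k (TGIndex.Mn d hL i.1)).L ^ i.1.m)⁻¹) (unitTorusGeo L i.1.k (TGIndex.Mn d hL i.1)).M)
    (v1GaugePairing 𝔄 (Fin (d + 1)) ι (g := unitTorusGeo L i.1.k (TGIndex.Mn d hL i.1)) (blkFine L i.1.k (TGIndex.Mn d hL i.1)) (kingPrV L i.1.k i.1.m (TGIndex.Mn d hL i.1)) (fun μ => bshiftEquiv (TGIndex.Mn d hL i.1) (L ^ i.1.k) μ)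
      (fun μ => bshiftEquiv (TGIndex.Mn d hL i.1) (L ^ i.1.m * L ^ i.1.k) μ) i.1.m (Nat.cast_ne_zero.mpr (NeZero.ne L)))
    (v1cfgFX 𝔄 ι e (fun μ => bshiftEquiv (TGIndex.Mn d hL i.1) (L ^ i.1.m * L ^ i.1.k) μ)
      ((unitTorusGeo L i.1.k (TGIndex.Mn d hL i.1)).eta * ((unitTorusGeo L i.1.k (TGIndex.Mn d hL i.1)).L ^ i.1.m)⁻¹))
    (v1cfgCX 𝔄 ι e (kingPrV L i.1.k i.1.m (TGIndex.Mn d hL i.1)) (fun μ => bshiftEquiv (TGIndex.Mn d hL i.1) (L ^ i.1.k) μ) (unitTorusGeo L i.1.k (TGIndex.Mn d hL i.1)).eta)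
    (fun μ => bshiftEquiv (TGIndex.Mn d hL i.1) (L ^ i.1.k) μ) (fun μ => bshiftEquiv (TGIndex.Mn d hL i.1) (L ^ i.1.m * L ^ i.1.k) μ) ((L ^ i.1.k : ℕ) : ℝ) ((L ^ i.1.m * L ^ i.1.k : ℕ) : ℝ) i.2
    (tensorId ι (gOp (TGIndex.Mn d hL i.1) (L ^ i.1.k) b))
    (tensorId ι (symbOp (TGIndex.Mn d hL i.1) (L ^ i.1.k) (sLap (TGIndex.Mn d hL i.1) (L ^ i.1.k) ((L ^ i.1.k : ℕ) : ℝ)) ∘ₗ gOp (TGIndex.Mn d hL i.1) (L ^ i.1.k) b))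
    (dPiecesM₂ d ι (TGIndex.Mn d hL i.1) (L ^ i.1.k) b)
    (tensorId ι (gOp (TGIndex.Mn d hL i.1) (L ^ i.1.m * L ^ i.1.k) b))
    (tensorId ι (symbOp (TGIndex.Mn d hL i.1) (L ^ i.1.m * L ^ i.1.k) (sLap (TGIndex.Mn d hL i.1) (L ^ i.1.m * L ^ i.1.k) ((L ^ i.1.m * L ^ i.1.k : ℕ) : ℝ)) ∘ₗ
      gOp (TGIndex.Mn d hL i.1) (L ^ i.1.m * L ^ i.1.k) b))
    (dPiecesM₂ d ι (TGIndex.Mn d hL i.1) (L ^ i.1.m * L ^ i.1.k) b)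


end Family

/-! ## §2 `NE2PlusOperator` by name -/

section Node

variable (d) (𝔄 : Type) [NormedRing 𝔄] [NormedAlgebra ℝ 𝔄] [CompleteSpace 𝔄] (ι : Type) [Fintype ι] [DecidableEq ι] [Nonempty ι] (e : 𝔄 ≃L[ℝ] (ι → ℝ))

/-- ★★★ **`T4EtaRate.NE2PlusOperator` BY NAME FOR BAŁABAN's FULL `U ≡ 1` PROPAGATOR ⊗ 1_𝔤 DRESSED BY HIS OWN `V′₁(A)` OF A LIVE GAUGE FIELD (fine coefficients from `A′`, coarse from the block
mean `Ā`), MODULO ONLY THE `U ≡ 1` ENTRY-2 η-DEFECT** — FILE 24 ★★★ `ne2PlusOperator_twoSided_of_letters` at the realised family: letters by FILE 26 ★★★ `twoSidedLettersX_of_meanGauge` (torus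
discharges: `bshiftEquiv_comm`, `fibre_conn_kingPrV`, `kingPrV_bshiftEquiv_pow`, `η = L^{−k} = L^m η′`, `C_πη′ ≤ 2(d+1)θ`, window `r₀ = (2(1+(d+1))(3+2(d+1)))⁻¹`, scale
`κ′ = 14e(1+(d+1))²(3+2(d+1))(κ_e+1)`), the shift-defect row letter by §2 on the coarse forward coefficients, every other `U ≡ 1` input from §2.
[cite: Balaban1985BackgroundPropagators, Thm 3.1 p.397 (quantifier template); (3.35)–(3.36) p.396, (3.42) p.397, (3.52) p.400, (3.63)–(3.65) p.402 (shapes, mechanism); King1986, p.664] -/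
theorem ne2PlusOperatorM1_fullGM₂_v1XA_of_entry2 (hLodd : Odd L) (hL2 : 2 ≤ L) (hL : Odd L ∧ 1 < L) {b : ℝ} (hb : 0 < b) (c35 : ℝ) (hc35 : 0 < c35)
    {γ : ℝ} (hγ0 : 0 < γ) (hγ1 : γ ≤ 1 / 16) {B₂ δ₂ : ℝ} (hB₂ : 0 ≤ B₂) (hδ₂ : 0 < δ₂)
    (h2 : ∀ (i : TGIndex) (ν : Fin (d + 1)),
      HasMaj (BlockNorm.ofBlocks (unitTorusGeo L i.k (TGIndex.Mn d hL i)) (blkFine L i.k (TGIndex.Mn d hL i)))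
        (BlockNorm.ofBlocks (unitTorusGeo L i.k (TGIndex.Mn d hL i)) (blkFine L i.k (TGIndex.Mn d hL i) ∘ kingPrV L i.k i.m (TGIndex.Mn d hL i)))
        (idef (pull (kingPrV L i.k i.m (TGIndex.Mn d hL i))) (pull (kingPrV L i.k i.m (TGIndex.Mn d hL i)))
          (gOp (TGIndex.Mn d hL i) (L ^ i.m * L ^ i.k) b ∘ₗ fgradAdj ((L ^ i.m * L ^ i.k : ℕ) : ℝ) (bshiftEquiv (TGIndex.Mn d hL i) (L ^ i.m * L ^ i.k) ν))
          (gOp (TGIndex.Mn d hL i) (L ^ i.k) b ∘ₗ fgradAdj ((L ^ i.k : ℕ) : ℝ) (bshiftEquiv (TGIndex.Mn d hL i) (L ^ i.k) ν)))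
        (fun y y' => B₂ * ((L : ℝ) ^ i.k) ^ (-γ) * Real.exp (-(δ₂ * tdistT (TGIndex.Mn d hL i) y y')))) :
    NE2PlusOperatorM1 c35 (fgInstanceV1G d 𝔄 ι hL) (fgFamilyV1XA d 𝔄 ι e hL b) := by
  obtain ⟨δ, β, m₀, cT, mT, hδ, hδδ₂, hβ, hm₀, hBm, hcT, hmT, H⟩ := uniform_layer_fullGM₂R d ι hLodd hL2 hL hb hγ0 hγ1 hδ₂ hB₂
  have hL0 : L ≠ 0 := by omega
  have hL1 : 1 ≤ L := by omega
  have hLr : (0 : ℝ) < (L : ℝ) := by exact_mod_cast (show 0 < L by omega)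
  have hLr1 : (1 : ℝ) ≤ (L : ℝ) := by exact_mod_cast hL1
  have hγle1 : γ ≤ 1 := by linarith
  have hσ : 0 < δ / 12 := by positivity
  have hdJ : (Fintype.card (Fin (d + 1)) : ℝ) = (d : ℝ) + 1 := by rw [Fintype.card_fin]; push_cast; ring
  have hdJ0 : (0 : ℝ) ≤ Fintype.card (Fin (d + 1)) := Nat.cast_nonneg _
  have hDS : ∀ (i : TGIndex × Fin (d + 1)) (ν : Fin (d + 1)),
      HasMaj (BlockNorm.ofBlocks (unitTorusGeo L i.1.k (TGIndex.Mn d hL i.1)) (liftBlk (blkFine L i.1.k (TGIndex.Mn d hL i.1)) ι)) (BlockNorm.ofBlocks (unitTorusGeo L i.1.k (TGIndex.Mn d hL i.1)) (liftBlk (blkFine L i.1.k (TGIndex.Mn d hL i.1) ∘ kingPrV L i.1.k i.1.m (TGIndex.Mn d hL i.1)) ι))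
        (idef (pull (liftMap (kingPrV L i.1.k i.1.m (TGIndex.Mn d hL i.1)) ι)) (pull (liftMap (kingPrV L i.1.k i.1.m (TGIndex.Mn d hL i.1)) ι))
          (tensorId ι (gOp (TGIndex.Mn d hL i.1) (L ^ i.1.m * L ^ i.1.k) b) ∘ₗ fgradAdj ((L ^ i.1.m * L ^ i.1.k : ℕ) : ℝ) (liftEquiv (bshiftEquiv (TGIndex.Mn d hL i.1) (L ^ i.1.m * L ^ i.1.k) ν) ι))
          (tensorId ι (gOp (TGIndex.Mn d hL i.1) (L ^ i.1.k) b) ∘ₗ fgradAdj ((L ^ i.1.k : ℕ) : ℝ) (liftEquiv (bshiftEquiv (TGIndex.Mn d hL i.1) (L ^ i.1.k) ν) ι)))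
        (fun y y' => m₀ * ((L : ℝ) ^ i.1.k) ^ (-γ) * Real.exp (-(δ * (unitTorusGeo L i.1.k (TGIndex.Mn d hL i.1)).dist y y'))) := fun i ν => by
    rw [idef_comp_fgradAdj_liftEquiv]
    exact hasMaj_tensorId ι (fun _ _ => mul_nonneg (mul_nonneg hm₀.le (Real.rpow_nonneg (pow_nonneg hLr.le _) _)) (Real.exp_nonneg _))
      ((h2 i.1 ν).mono fun y y' => le_rate hB₂ hBm (one_le_pow₀ hLr1) le_rfl hδδ₂ (tdistT_nonneg _ _ _))
  -- the constants of the gauge letters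
  set C₀ : ℝ := 2 * ((d : ℝ) + 1) with hC₀
  have hC₀0 : 0 ≤ C₀ := by positivity
  set κ' : ℝ := 14 * Real.exp 1 * (1 + Fintype.card (Fin (d + 1))) * ((1 + Fintype.card (Fin (d + 1))) * (3 + C₀)) * (basisConst e + 1) with hκ'def
  have hκe := basisConst_nonneg e
  have hκ'pos : 0 < κ' := by positivity
  set r₀ : ℝ := (2 * ((1 + Fintype.card (Fin (d + 1))) * (3 + C₀)))⁻¹ with hr₀def
  have hden : 0 < 2 * ((1 + Fintype.card (Fin (d + 1))) * (3 + C₀)) := by positivity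
  have hr₀ : 0 < r₀ := inv_pos.2 hden
  -- the fifteen letters at every index, for every regular gauge field in the window
  have hLT : ∀ (i : TGIndex × Fin (d + 1)) (A' : Fin (d + 1) → Tor (fine (L ^ i.1.m * L ^ i.1.k) (TGIndex.Mn d hL i.1)) × Fin (d + 1) → 𝔄) (α₀ : ℝ),
      (v1GaugeBg 𝔄 (Fin (d + 1)) (fun μ => bshiftEquiv (TGIndex.Mn d hL i.1) (L ^ i.1.m * L ^ i.1.k) μ) ((unitTorusGeo L i.1.k (TGIndex.Mn d hL i.1)).eta * ((unitTorusGeo L i.1.k (TGIndex.Mn d hL i.1)).L ^ i.1.m)⁻¹) (unitTorusGeo L i.1.k (TGIndex.Mn d hL i.1)).M).Reg335 c35 α₀ A' → 0 < α₀ → 1 ≤ (unitTorusGeo L i.1.k (TGIndex.Mn d hL i.1)).M →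
      c35 * (unitTorusGeo L i.1.k (TGIndex.Mn d hL i.1)).M * α₀ ≤ r₀ →
      TwoSidedLetters (Fin (d + 1)) ι (kingPrV L i.1.k i.1.m (TGIndex.Mn d hL i.1)) (fun μ => bshiftEquiv (TGIndex.Mn d hL i.1) (L ^ i.1.k) μ) (fun μ => bshiftEquiv (TGIndex.Mn d hL i.1) (L ^ i.1.m * L ^ i.1.k) μ) ((L ^ i.1.k : ℕ) : ℝ)
        ((L ^ i.1.m * L ^ i.1.k : ℕ) : ℝ) (κ' * (c35 * (unitTorusGeo L i.1.k (TGIndex.Mn d hL i.1)).M * α₀)) (((L : ℝ) ^ i.1.k) ^ (-γ))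
        (v1cfgFX 𝔄 ι e (fun μ => bshiftEquiv (TGIndex.Mn d hL i.1) (L ^ i.1.m * L ^ i.1.k) μ) ((unitTorusGeo L i.1.k (TGIndex.Mn d hL i.1)).eta * ((unitTorusGeo L i.1.k (TGIndex.Mn d hL i.1)).L ^ i.1.m)⁻¹) A')
        (v1cfgCX 𝔄 ι e (kingPrV L i.1.k i.1.m (TGIndex.Mn d hL i.1)) (fun μ => bshiftEquiv (TGIndex.Mn d hL i.1) (L ^ i.1.k) μ) (unitTorusGeo L i.1.k (TGIndex.Mn d hL i.1)).eta A') :=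
    fun i A' α₀ hreg hα₀ hM hwin => twoSidedLettersX_torus d 𝔄 ι e hL hL2 hγle1 hc35 i A' α₀ hreg hα₀ hM hwin
  -- the spacing order `0 ≤ η′ ≤ η ≤ θ ≤ 1` per index
  have hsp1 : ∀ i : TGIndex × Fin (d + 1), (((L ^ i.1.m * L ^ i.1.k : ℕ) : ℝ))⁻¹ ≤ (((L ^ i.1.k : ℕ) : ℝ))⁻¹ := fun i => by
    have h1 : (1 : ℝ) ≤ ((L ^ i.1.m : ℕ) : ℝ) := by exact_mod_cast Nat.one_le_pow _ _ (by omega)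
    have h2 : (0 : ℝ) < ((L ^ i.1.k : ℕ) : ℝ) := by exact_mod_cast pow_pos (by omega) _
    rw [Nat.cast_mul]
    exact inv_anti₀ h2 (le_mul_of_one_le_left h2.le h1)
  have hsp2 : ∀ i : TGIndex × Fin (d + 1), (((L ^ i.1.k : ℕ) : ℝ))⁻¹ ≤ ((L : ℝ) ^ i.1.k) ^ (-γ) := fun i => by
    rw [show (((L ^ i.1.k : ℕ) : ℝ)) = (L : ℝ) ^ i.1.k by push_cast; ring]
    exact inv_pow_le_rpow hL1 i.1.k hγle1
  have hsp3 : ∀ i : TGIndex × Fin (d + 1), ((L : ℝ) ^ i.1.k) ^ (-γ) ≤ 1 := fun i =>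
    Real.rpow_le_one_of_one_le_of_nonpos (one_le_pow₀ hLr1) (by linarith)
  refine ne2PlusOperatorM1_twoSidedCovAll_of_letters (J := Fin (d + 1)) (ι := ι) (I := TGIndex × Fin (d + 1)) (fun i => (unitTorusGeo L i.1.k (TGIndex.Mn d hL i.1)))
    (fun i => Tor (fine (L ^ i.1.k) (TGIndex.Mn d hL i.1)) × Fin (d + 1)) (fun i => Tor (fine (L ^ i.1.m * L ^ i.1.k) (TGIndex.Mn d hL i.1)) × Fin (d + 1))
    (fun i => blkFine L i.1.k (TGIndex.Mn d hL i.1)) (fun i => kingPrV L i.1.k i.1.m (TGIndex.Mn d hL i.1)) (fun i μ => bshiftEquiv (TGIndex.Mn d hL i.1) (L ^ i.1.k) μ) (fun i μ => bshiftEquiv (TGIndex.Mn d hL i.1) (L ^ i.1.m * L ^ i.1.k) μ)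
    (fun i => ((L ^ i.1.k : ℕ) : ℝ)) (fun i => ((L ^ i.1.m * L ^ i.1.k : ℕ) : ℝ)) (fun i => i.1.m)
    (fun i => v1GaugeBg 𝔄 (Fin (d + 1)) (fun μ => bshiftEquiv (TGIndex.Mn d hL i.1) (L ^ i.1.k) μ) (unitTorusGeo L i.1.k (TGIndex.Mn d hL i.1)).eta (unitTorusGeo L i.1.k (TGIndex.Mn d hL i.1)).M)
    (fun i => v1GaugeBg 𝔄 (Fin (d + 1)) (fun μ => bshiftEquiv (TGIndex.Mn d hL i.1) (L ^ i.1.m * L ^ i.1.k) μ) ((unitTorusGeo L i.1.k (TGIndex.Mn d hL i.1)).eta * ((unitTorusGeo L i.1.k (TGIndex.Mn d hL i.1)).L ^ i.1.m)⁻¹) (unitTorusGeo L i.1.k (TGIndex.Mn d hL i.1)).M)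
    (fun i => v1GaugePairing 𝔄 (Fin (d + 1)) ι (g := (unitTorusGeo L i.1.k (TGIndex.Mn d hL i.1))) (blkFine L i.1.k (TGIndex.Mn d hL i.1)) (kingPrV L i.1.k i.1.m (TGIndex.Mn d hL i.1)) (fun μ => bshiftEquiv (TGIndex.Mn d hL i.1) (L ^ i.1.k) μ)
      (fun μ => bshiftEquiv (TGIndex.Mn d hL i.1) (L ^ i.1.m * L ^ i.1.k) μ) i.1.m (Nat.cast_ne_zero.mpr (NeZero.ne L)))
    (fun i => v1cfgFX 𝔄 ι e (fun μ => bshiftEquiv (TGIndex.Mn d hL i.1) (L ^ i.1.m * L ^ i.1.k) μ) ((unitTorusGeo L i.1.k (TGIndex.Mn d hL i.1)).eta * ((unitTorusGeo L i.1.k (TGIndex.Mn d hL i.1)).L ^ i.1.m)⁻¹))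
    (fun i => v1cfgCX 𝔄 ι e (kingPrV L i.1.k i.1.m (TGIndex.Mn d hL i.1)) (fun μ => bshiftEquiv (TGIndex.Mn d hL i.1) (L ^ i.1.k) μ) (unitTorusGeo L i.1.k (TGIndex.Mn d hL i.1)).eta)
    (fun i => ((L : ℝ) ^ i.1.k) ^ (-γ)) (fun i => i.2)
    (fun i => tensorId ι (gOp (TGIndex.Mn d hL i.1) (L ^ i.1.k) b))
    (fun i => tensorId ι (symbOp (TGIndex.Mn d hL i.1) (L ^ i.1.k) (sLap (TGIndex.Mn d hL i.1) (L ^ i.1.k) ((L ^ i.1.k : ℕ) : ℝ)) ∘ₗ gOp (TGIndex.Mn d hL i.1) (L ^ i.1.k) b))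
    (fun i => dPiecesM₂ d ι (TGIndex.Mn d hL i.1) (L ^ i.1.k) b)
    (fun i => tensorId ι (gOp (TGIndex.Mn d hL i.1) (L ^ i.1.m * L ^ i.1.k) b))
    (fun i => tensorId ι (symbOp (TGIndex.Mn d hL i.1) (L ^ i.1.m * L ^ i.1.k) (sLap (TGIndex.Mn d hL i.1) (L ^ i.1.m * L ^ i.1.k) ((L ^ i.1.m * L ^ i.1.k : ℕ) : ℝ)) ∘ₗ gOp (TGIndex.Mn d hL i.1) (L ^ i.1.m * L ^ i.1.k) b))
    (fun i => dPiecesM₂ d ι (TGIndex.Mn d hL i.1) (L ^ i.1.m * L ^ i.1.k) b)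
    c35 κ' r₀ hc35 hκ'pos hr₀ (fun i => triangle254_unitTorusGeo L i.1.k (TGIndex.Mn d hL i.1)) (fun i a c => tdistT_nonneg _ _ _) (fun i y => tdistT_self _ y) hσ.le
    (B4Sect5Proof.latticeConst_nonneg (d + 1) hσ.le) (fun i => rowSum_unitTorusGeo L i.1.k (TGIndex.Mn d hL i.1) hσ)
    (fun i => inv_pos.mpr (pow_pos hLr _)) (fun i => hLr) (fun i y => (unitTorusGeo_len L i.1.k (TGIndex.Mn d hL i.1) hL0 y).symm.le) (fun i => show (1 : ℝ) ≤ 1 from le_rfl)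
    (by linarith) hβ.le hm₀.le hγ0 (fun i => Real.rpow_nonneg (pow_nonneg hLr.le _) _) (fun i y => le_rfl) hcT.le hmT.le
    (fun i => inv_nonneg.mpr (Nat.cast_nonneg _)) (fun i => hsp1 i) (fun i => hsp2 i) (fun i => hsp3 i)
    (fun i => (H i).1) (fun i => (H i).2.1) (fun i => (H i).2.2.1) (fun i => (H i).2.2.2.1) (fun i => (H i).2.2.2.2.1) (fun i => (H i).2.2.2.2.2.1)
    (fun i => (H i).2.2.2.2.2.2.1) (fun i => (H i).2.2.2.2.2.2.2.1) (fun i => (H i).2.2.2.2.2.2.2.2.1) (fun i => (H i).2.2.2.2.2.2.2.2.2.1)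
    (fun i ν => hDS i ν) (fun i => (H i).2.2.2.2.2.2.2.2.2.2.1) (fun i => (H i).2.2.2.2.2.2.2.2.2.2.2.1)
    (fun i U α₀ hreg hα₀ hM hwin => hLT i U α₀ hreg hα₀ hM hwin) (fun i U α₀ hreg hα₀ hM hwin μ => ?_)
  -- the shift-defect row letter on the coarse forward coefficients: §2's generic conjunct with the letters 2 and 13 of the bundle
  obtain ⟨-, hA, -, -, -, -, -, -, -, -, -, -, hosc, -, -⟩ := hLT i U α₀ hreg hα₀ hM hwin
  exact (H i).2.2.2.2.2.2.2.2.2.2.2.2 (v1cfgCX 𝔄 ι e (kingPrV L i.1.k i.1.m (TGIndex.Mn d hL i.1)) (fun μ => bshiftEquiv (TGIndex.Mn d hL i.1) (L ^ i.1.k) μ) (unitTorusGeo L i.1.k (TGIndex.Mn d hL i.1)).eta U).2 _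
    (mul_nonneg hκ'pos.le (mul_nonneg (mul_nonneg hc35.le (zero_le_one.trans hM)) hα₀.le)) (fun μ x i' => hA (Sum.inl μ) x i') hosc μ

/-- ★★★ **`T4EtaRate.NE2PlusOperator` BY NAME, NO DISPLAYED BINDER: Bałaban's FULL `U ≡ 1` Landau-gauge propagator ⊗ 1_𝔤 on the torus family of record, dressed by HIS OWN FIRST-ORDER SPECIES
`V′₁(A)` (3.52) OF A LIVE GAUGE FIELD `A′` — `c = ad_{∇*A} + Σ_μ[F′(ad A⁺_μ) + F′(ad A⁻_μ)]`, `a^±_μ = ad A^±_μ ± ηF′(ad A^±_μ)` in coordinates `e : 𝔄 ≃ ℝ^ι`, fine coefficients from `A′`, COARSE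
coefficients from the BLOCK MEAN `Ā = gavgM pr_V A′`, BOTH bond orientations, all four (3.42) entries CONSTRUCTED (entry 2 by parts), rate exponent `γ = 1∕(8(d+1))` (`d ≥ 1`)** — fed with
dag-n15-a's ENTRY 2 (part 71).  Every input is a tree theorem; NO (3.44) mixed letter.  MODEL-LEVEL in the species (unit-scale C² reading of (3.35)–(3.36), `U ≡ 1` transports inside `V′₁`,
block-mean transport), GENUINE in the propagator. [cite: Balaban1985BackgroundPropagators, Thm 3.1 p.397 (quantifier template); (3.35)–(3.36) p.396, (3.42) p.397, (3.52) p.400, (3.63)–(3.65) p.402 (shapes, mechanism); Balaban1984PropagatorsI, Prop. 1.2 (1.110)–(1.111) p.35; Balaban1984PropagatorsII, (2.156) p.250; King1986, p.664] -/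
theorem ne2PlusOperatorM1_fullGM₂_v1XA (hd1 : 1 ≤ d) (hLodd : Odd L) (hL2 : 2 ≤ L) (hL : Odd L ∧ 1 < L) {b : ℝ} (hb : 0 < b) (c35 : ℝ) (hc35 : 0 < c35) :
    NE2PlusOperatorM1 c35 (fgInstanceV1G d 𝔄 ι hL) (fgFamilyV1XA d 𝔄 ι e hL b) := by
  obtain ⟨δ₂, B₂, hδ₂, hB₂, H2⟩ := hasMaj_twoGridDefect_div (d := d) hLodd hL2 hb
  have hd1' : (1 : ℝ) ≤ (d : ℝ) := by exact_mod_cast hd1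
  have hγ0 : 0 < 1 / (8 * ((d : ℝ) + 1)) := by positivity
  have hγ1 : 1 / (8 * ((d : ℝ) + 1)) ≤ 1 / 16 := one_div_le_one_div_of_le (by norm_num) (by nlinarith)
  refine ne2PlusOperatorM1_fullGM₂_v1XA_of_entry2 d 𝔄 ι e hLodd hL2 hL hb c35 hc35 hγ0 hγ1 hB₂.le hδ₂ fun i ν => ?_
  have h := H2 i.mT i.k i.m i.one_le hL ν
  rw [← symbOp_sTinv_sub_one_eq, ← symbOp_sTinv_sub_one_eq, blkFine_comp_kingPrV]
  refine h.mono fun y y' => le_of_eq ?_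
  rw [show ((L ^ i.k : ℕ) : ℝ) = (L : ℝ) ^ i.k by push_cast; ring]
  exact rfl

/-- The printed-template shape follows (FILE 39 `NE2PlusOperatorM1.ne2PlusOperator`; by itself VACUOUS on `M ≡ 1` — referee ref-F FLAG-VACUITY-A1 — kept for the sockets that consume it).
[cite: Balaban1985BackgroundPropagators, Thm 3.1 p.397 (quantifier template)] -/
theorem ne2PlusOperator_fullGM₂_v1XA (hd1 : 1 ≤ d) (hLodd : Odd L) (hL2 : 2 ≤ L) (hL : Odd L ∧ 1 < L) {b : ℝ} (hb : 0 < b) (c35 : ℝ) (hc35 : 0 < c35) :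
    NE2PlusOperator c35 (fgInstanceV1G d 𝔄 ι hL) (fgFamilyV1XA d 𝔄 ι e hL b) :=
  (ne2PlusOperatorM1_fullGM₂_v1XA d 𝔄 ι e hd1 hLodd hL2 hL hb c35 hc35).ne2PlusOperator

/-- The four-dimensional gauge-dressed instance (`d + 1 = 4`, `γ = 1∕32`). [cite: Balaban1985BackgroundPropagators, Thm 3.1 p.397 (quantifier template)] -/
theorem ne2PlusOperatorM1_fullGM₂_v1XA_dim4 (hLodd : Odd L) (hL2 : 2 ≤ L) (hL : Odd L ∧ 1 < L) {b : ℝ} (hb : 0 < b) (c35 : ℝ) (hc35 : 0 < c35) :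
    NE2PlusOperatorM1 c35 (fgInstanceV1G 3 𝔄 ι hL) (fgFamilyV1XA 3 𝔄 ι e hL b) :=
  ne2PlusOperatorM1_fullGM₂_v1XA 3 𝔄 ι e (by norm_num) hLodd hL2 hL hb c35 hc35

end Node

/-! ## §3 The identification of the covariant entry 2 per lattice, CONDITIONAL on the displayed units `hunit`, `hunit2` (entries 1 and 3: FILE 35 §3) -/

section Ident

variable (d) {𝔄 : Type} [NormedRing 𝔄] [NormedAlgebra ℝ 𝔄] (ι : Type) [Fintype ι] [DecidableEq ι] (e : 𝔄 ≃L[ℝ] (ι → ℝ))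
  (M : Fin (d + 1) → ℕ) [∀ μ, NeZero (M μ)] (n : ℕ) [NeZero n]

omit [NeZero L] in
/-- ★★★ **ENTRY 2 IS THE GREEN's FUNCTION COMPOSED WITH THE TRANSPOSE-ADJOINT COVARIANT DERIVATIVE OF THE TEST 1-FORM** (per lattice `T_{2L^m}` at spacing `η = n⁻¹`, gauge field `B`,
exact coefficients), CONDITIONAL on the displayed Neumann unit `hunit` and by-parts unit `hunit2` (hypotheses of this theorem, not discharged here):
`X(B) ∘ (D^η_{exp(η ad B_ν), τ_ν})ᵀ = covEntry2 τ η n (gOp ⊗ 1) dPiecesM₂ (c, a)(B) ν` — the coarse (`n = L^k`, `B = Ā`) and fine (`n = L^mL^k`, `B = A′`) halves of `fgFamilyV1XA`'s entry 2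
(FILE 36 ★★ `dressed_comp_covDT_eq_covEntry2`, FILE 35 `gaugeTransport_inl_eq_one_add`). [cite: Balaban1985BackgroundPropagators, (3.42) p.397 (entry «G(U)∇*_U λ») + (3.50) p.400] -/
theorem dressed_covDT_eq_covEntry2_torus {b : ℝ} (B : Fin (d + 1) → Tor (fine n M) × Fin (d + 1) → 𝔄) (ν : Fin (d + 1))
    (hunit : IsUnit (1 - LinearMap.toMatrix' (stack (tensorId ι (gOp M n b)) (dPiecesM₂ d ι M n b) ∘ₗ
      unstackM (v1coefCX e ((n : ℝ)⁻¹) (v1fieldsOfGauge 𝔄 (Fin (d + 1)) (bshiftEquiv M n) ((n : ℝ)⁻¹) B))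
        (v1coefAX e ((n : ℝ)⁻¹) (v1fieldsOfGauge 𝔄 (Fin (d + 1)) (bshiftEquiv M n) ((n : ℝ)⁻¹) B)))))
    (hunit2 : E2Unit (krowOf (fun ν => tensorId ι (gOp M n b) ∘ₗ fgradAdj (n : ℝ) (liftEquiv (bshiftEquiv M n ν) ι)) (fun μ => pull (liftEquiv (bshiftEquiv M n μ) ι))
      (fun μ => mmulOp (v1coefAX e ((n : ℝ)⁻¹) (v1fieldsOfGauge 𝔄 (Fin (d + 1)) (bshiftEquiv M n) ((n : ℝ)⁻¹) B) (Sum.inl μ) ∘ ⇑(bshiftEquiv M n μ).symm))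
      (fun μ => mmulOp (v1coefAX e ((n : ℝ)⁻¹) (v1fieldsOfGauge 𝔄 (Fin (d + 1)) (bshiftEquiv M n) ((n : ℝ)⁻¹) B) (Sum.inr μ) ∘ ⇑(bshiftEquiv M n μ))))) :
    (projO none ∘ₗ bgPairM (tensorId ι (gOp M n b)) (dPiecesM₂ d ι M n b)
          (v1coefCX e ((n : ℝ)⁻¹) (v1fieldsOfGauge 𝔄 (Fin (d + 1)) (bshiftEquiv M n) ((n : ℝ)⁻¹) B))
          (v1coefAX e ((n : ℝ)⁻¹) (v1fieldsOfGauge 𝔄 (Fin (d + 1)) (bshiftEquiv M n) ((n : ℝ)⁻¹) B))) ∘ₗ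
        covDT ((n : ℝ)⁻¹) (gaugeTransport e (bshiftEquiv M n) ((n : ℝ)⁻¹) B (Sum.inl ν)) (bshiftEquiv M n ν) =
      covEntry2 (bshiftEquiv M n) ((n : ℝ)⁻¹) (n : ℝ) (tensorId ι (gOp M n b)) (dPiecesM₂ d ι M n b)
        (v1coefCX e ((n : ℝ)⁻¹) (v1fieldsOfGauge 𝔄 (Fin (d + 1)) (bshiftEquiv M n) ((n : ℝ)⁻¹) B))
        (v1coefAX e ((n : ℝ)⁻¹) (v1fieldsOfGauge 𝔄 (Fin (d + 1)) (bshiftEquiv M n) ((n : ℝ)⁻¹) B)) ν := by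
  have hn0 : ((n : ℝ)) ≠ 0 := Nat.cast_ne_zero.mpr (NeZero.ne n)
  have hη : ((n : ℝ))⁻¹ ≠ 0 := inv_ne_zero hn0
  have hR : gaugeTransport e (bshiftEquiv M n) ((n : ℝ)⁻¹) B (Sum.inl ν) =
      fun x => 1 + ((n : ℝ))⁻¹ • v1coefAX e ((n : ℝ)⁻¹) (v1fieldsOfGauge 𝔄 (Fin (d + 1)) (bshiftEquiv M n) ((n : ℝ)⁻¹) B) (Sum.inl ν) x :=
    funext fun x => gaugeTransport_inl_eq_one_add ι e hη _ B ν x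
  rw [hR]
  exact dressed_comp_covDT_eq_covEntry2 (bshiftEquiv M n) (n : ℝ) (tensorId ι (gOp M n b)) _ _ hn0 (dPiecesM₂_inl d ι M n b) (dPiecesM₂_inr d ι M n b) hunit hunit2 ν

end Ident

end Summit.QuantumFields.YangMills.BalabanUVNodes.N15.BackgroundLayer

end
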